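import Mathlib.NumberTheory.Bertrand
import Mathlib.FieldTheory.Finite.Basic
import Mathlib.GroupTheory.Perm.Cycle.Type
import Mathlib.Analysis.SpecialFunctions.Pow.Asymptotics
import Literature.Computability.Complexity.CircuitComposition
import Literature.Computability.Cryptography.NaorReingoldDDH
import HarnessLib

/-!
# DDH instances exist, and hard ones have large subgroup order (sibling proof file of `NaorReingoldDDH.lean`)

`NaorReingoldDDH.lean` vendors Naor–Reingold's decisional Diffie–Hellman assumption in the
non-uniform subexponential form `SubexpDDH := ∃ P Q g, DDHSubexpHard P Q g` consumed by the
natural-proofs barrier (`Literature.Barriers.PneNP.NaturalProofsTC0DDH`). That statement is an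
OPEN CONJECTURE — Assumption 3.1 of the source is *posed* ("How much confidence can we have in the
DDH-Assumption?", §3.1.1, p. 240), never proved, and every result of the paper is of the form "if the
DDH-Assumption holds, then …" (Thm. 4.1, Thm. 4.3, Cor. 5.1); a proof of `SubexpDDH` would in
particular separate `P` from `NP` (under `P = NP` discrete logarithms modulo `P`, an `NP` search
problem, are computed by polynomial-size circuits, which decide `c = ab` exactly). So there is no
`SubexpDDH_holds` here (CONVENTIONS §4: open conjectures stay `def … : Prop`, used on the left of
implications).

What IS provable, and proved here, is that the *instance* conjunct of `DDHSubexpHard` is satisfiable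
at every security parameter: §3.2 (p. 242) lets the instance generator `IG` "choose an `n`-bit prime
`P` with an `ℓ(n)`-bit prime `Q` that divides `P - 1`" and `g` of order `Q` in `ℤ_P^*`, taking the
existence of such triples for granted. `exists_isDDHInstance` supplies them for every `m ≥ 2`:
an `m`-bit prime `P` by Bertrand's postulate (`Nat.exists_prime_lt_and_le_two_mul`, and `P ≠ 2^m`
as `P` is an odd prime), `Q` the least prime factor of `P - 1 ≥ 2`, and `g < P` the canonical
representative of an element of order `Q` of `(ℤ/P)ˣ` (Cauchy's theorem
`exists_prime_orderOf_dvd_card` in a group of order `P - 1`, `ZMod.card_units`). Hence the open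
content of `SubexpDDH` is exactly its hardness clause (which, beyond existence, forces `Q_m` to be
large — p. 240: "the best known algorithm for general groups has time square root of the size of the
largest prime divisor" — e.g. the size-`m` circuit testing `z = 1` already has advantage
`(Q - 1)/Q²`). For `m ≤ 1` there is no instance (`m = 0`: `1 ≤ 2P` and `P < 1` fail; `m = 1`: no
prime `P < 2`), so `2 ≤ m` is sharp.

## The hardness clause has teeth: `Q_m` must be superpolynomial

The second group of results checks that the formal hardness clause of `DDHSubexpHard` (every
`B₂`-circuit of size `≤ 2^{m^δ}` has advantage `< 2^{-m^δ}`) is not satisfied by degenerate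
instance sequences, in the one way that needs no number theory: the bias of `ab mod Q` towards `0`.
The circuit "accept iff the third element is `1`" is a conjunction of `m` literals on the third
block (`cktSize_all_beq`, `exists_circuit_thirdIsOne`: `m + 1` gates over `B₂`, via the tree's
straight-line-program calculus `CktSize` of `CircuitComposition.lean`); on `⟨g^a, g^b, g^{ab}⟩` it
accepts iff `Q ∣ ab`, i.e. `a = 0 ∨ b = 0` (`2Q - 1` pairs, `two_mul_le_ddhRealAccept_thirdIsOne`),
on `⟨g^a, g^b, g^c⟩` iff `c = 0` (`Q²` triples, `ddhRandAccept_thirdIsOne_le`), so its advantage is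
`≥ (Q - 1)/Q²` (`ddhAdvantage_thirdIsOne_ge`). Since `m + 1 ≤ 2^{m^δ}` eventually
(`eventually_natCast_succ_le_two_rpow`, from `log x = o(x^δ)`), hardness gives
`(Q_m - 1)/Q_m² < 2^{-m^δ}`, whence **`2^{m^δ} < 2 Q_m` for all large `m`**
(`DDHSubexpHard.eventually_two_rpow_lt`) and no sequence with bounded `Q_m` is hard
(`not_ddhSubexpHard_of_bounded`). This is the formal shadow of the source's insistence on "`Q` a
(large) prime divisor of `P - 1`" (§3.2, p. 242; p. 240: generic discrete-log algorithms run in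
time `√Q`) — the genuine cryptanalytic constraints (Pohlig–Hellman/Pollard `√Q`, the number field
sieve `L_P[1/3]`, which is why `δ < 1/3` is needed for `ℤ_P^*`) are of course not formalised.

## References

* [NaorReingold2004] M. Naor, O. Reingold, *Number-theoretic constructions of efficient
  pseudo-random functions*, J. ACM 51 (2004) 231–262: §3.2 (p. 242, instance generator),
  Assumption 3.1 (p. 243), §3.1.1 (p. 240).
-/

namespace Literature.Computability.Cryptography

open Complexity Finset Filter

/-- **DDH instances exist at every security parameter `m ≥ 2`**: there is an `m`-bit prime `P`
(Bertrand's postulate), a prime `Q ∣ P - 1` (its least prime factor; `P - 1 ≥ 2`), and `g < P` of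
order exactly `Q` in `ℤ_P^*` (Cauchy's theorem in the group `(ℤ/P)ˣ` of order `P - 1`). So the
instance conjunct of `DDHSubexpHard` is satisfiable — a (deterministic) instance generator `IG` as in
§3.2 exists, which the source takes for granted ("choose an `n`-bit prime `P` with an `ℓ(n)`-bit
prime `Q` that divides `P - 1`"); the open content of `SubexpDDH` is the hardness clause alone.
[cite: NaorReingold2004, §3.2 (p. 242)] -/
theorem exists_isDDHInstance {m : ℕ} (hm : 2 ≤ m) : ∃ P Q g : ℕ, IsDDHInstance m P Q g := by
  obtain ⟨P, hP, hltP, hPle⟩ := Nat.exists_prime_lt_and_le_two_mul (2 ^ (m - 1)) (by positivity)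
  have h2m : 2 * 2 ^ (m - 1) = 2 ^ m := by
    rw [← pow_succ']
    congr 1
    omega
  rw [h2m] at hPle
  have hP2 : 2 ≤ 2 ^ (m - 1) :=
    calc (2 : ℕ) = 2 ^ 1 := rfl
      _ ≤ 2 ^ (m - 1) := Nat.pow_le_pow_right (by norm_num) (by omega)
  have hP3 : 3 ≤ P := by omega
  have hPlt : P < 2 ^ m := by
    rcases hPle.lt_or_eq with h | h
    · exact h
    · exfalso
      have h2 : 2 ∣ P := by
        rw [h]
        exact dvd_pow_self 2 (by omega)
      have h22 := (Nat.prime_dvd_prime_iff_eq Nat.prime_two hP).1 h2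
      omega
  haveI : Fact P.Prime := ⟨hP⟩
  haveI : NeZero P := ⟨hP.ne_zero⟩
  have hP1 : P - 1 ≠ 1 := by omega
  have hQp : ((P - 1).minFac).Prime := Nat.minFac_prime hP1
  haveI : Fact ((P - 1).minFac).Prime := ⟨hQp⟩
  have hcard : (P - 1).minFac ∣ Fintype.card (ZMod P)ˣ := by
    rw [ZMod.card_units]
    exact Nat.minFac_dvd _
  obtain ⟨u, hu⟩ := exists_prime_orderOf_dvd_card (P - 1).minFac hcard
  refine ⟨P, (P - 1).minFac, (u : ZMod P).val,
    ⟨hP, hQp, Nat.minFac_dvd _, by omega, hPlt, ZMod.val_lt _, ?_⟩⟩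
  rw [ZMod.natCast_zmod_val, orderOf_units, hu]

/-- There is no DDH instance at security parameter `m ≤ 1` (no prime has at most one bit), so the
hypothesis `2 ≤ m` of `exists_isDDHInstance` is sharp; irrelevant for `DDHSubexpHard`, which only
speaks about all sufficiently large `m`. [cite: NaorReingold2004, §3.2 (p. 242)] -/
theorem not_isDDHInstance_of_le_one {m P Q g : ℕ} (hm : m ≤ 1) : ¬ IsDDHInstance m P Q g := by
  intro h
  have h2 : 2 ≤ P := h.prime_P.two_le
  have hlt : P < 2 ^ m := h.lt_two_pow
  interval_cases m <;> simp at hlt <;> omega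


/-! ### The hardness clause forces `Q_m` to be large

The distinguisher "accept iff the third group element is `1`" (i.e. `c = 0`, resp. `ab = 0`) is a
conjunction of `m` literals on the bits of the third block, a `B₂`-circuit with `m + 1` gates; it
accepts `2Q - 1` of the `Q²` Diffie–Hellman pairs and `Q²` of the `Q³` random triples, so its
advantage is `(Q - 1)/Q²`. Hence `DDHSubexpHard P Q g` forces `2^{m^δ} < 2 Q_m` for all large `m`:
the subgroup order must be superpolynomial ("`Q` a (large) prime divisor of `P - 1`", §3.2; "the
best known algorithm for general groups has time square root of the size of the largest prime
divisor", p. 240). -/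

section QLarge

open Asymptotics

/-- A conjunction of literals `⋀ᵢ (xᵢ = pᵢ)` over a list of variables is computed by a `B₂`
straight-line program with one gate per literal plus one constant gate (Vollmer 1999, §1.1:
chains of fan-in-`2` gates). [folklore] -/
theorem cktSize_all_beq {ι : Type*} (p : ι → Bool) : ∀ l : List ι,
    CktSize B2 (fun (x : ι → Bool) (_ : Unit) => l.all fun i => x i == p i) (l.length + 1)
  | [] => by simpa using cktSize_const ι true
  | i :: l => by
    have h1 : CktSize B2 (fun (x : ι → Bool) =>
        Sum.elim (fun (_ : Unit) => l.all fun i => x i == p i) x) (l.length + 1 + 0) :=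
      (cktSize_all_beq p l).pair (CktSize.id B2)
    have h2 : CktSize B2 (fun (y : Unit ⊕ ι → Bool) (_ : Unit) =>
        (y (.inl ()) && (y (.inr i) == p i))) 1 :=
      (CktSize.gate (B := B2) ⟨2, fun v => v 0 && (v 1 == p i)⟩ (by simp [B2])
        ![Sum.inl (), Sum.inr i]).congr fun y _ => by simp
    refine ((h1.comp h2).congr fun x _ => ?_).of_le (by simp)
    simp [Bool.and_comm]

/-- The test "the third block is the binary expansion of `1`" (bit `0` set, all other bits clear)
on `3m` input bits is computed by a `B₂`-circuit with at most `m + 1` gates. [folklore] -/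
theorem exists_circuit_thirdIsOne (m : ℕ) :
    ∃ C : Circuit (Fin 3 × Fin m), C.IsOver B2 ∧ C.size ≤ m + 1 ∧
      ∀ w, C.eval w = (List.finRange m).all fun j => w (2, j) == decide ((j : ℕ) = 0) := by
  have h := cktSize_all_beq (fun ji : Fin 3 × Fin m => decide ((ji.2 : ℕ) = 0))
    ((List.finRange m).map fun j => ((2 : Fin 3), j))
  obtain ⟨C, hC, hs, he⟩ := h.toCircuit
  refine ⟨C, hC, by simpa using hs, fun w => ?_⟩
  rw [he]
  simp [List.all_map, Function.comp_def]

/-- Bit `i` of `1` is set iff `i = 0`. [folklore] -/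
theorem testBit_one_eq_decide (i : ℕ) : Nat.testBit 1 i = decide (i = 0) := by
  cases i with
  | zero => rfl
  | succ i => simp [Nat.testBit_succ]

/-- For `n < 2^m` with `m ≥ 1`: all `m` low bits of `n` agree with those of `1` iff `n = 1`.
[folklore] -/
theorem all_testBit_iff {m n : ℕ} (hm : 1 ≤ m) (hn : n < 2 ^ m) :
    ((List.finRange m).all fun j : Fin m => n.testBit j == decide ((j : ℕ) = 0)) = true ↔
      n = 1 := by
  simp only [List.all_eq_true, List.mem_finRange, true_implies, beq_iff_eq]
  constructor
  · intro h
    apply Nat.eq_of_testBit_eq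
    intro i
    rw [testBit_one_eq_decide]
    by_cases hi : i < m
    · exact h ⟨i, hi⟩
    · have hi : m ≤ i := not_lt.1 hi
      have h2 : n < 2 ^ i := lt_of_lt_of_le hn (Nat.pow_le_pow_right two_pos hi)
      rw [Nat.testBit_eq_false_of_lt h2]
      have : i ≠ 0 := by omega
      simp [this]
  · rintro rfl j
    exact testBit_one_eq_decide j

/-- On the encoding of a triple `t`, the test circuit accepts iff `t₂ = 1` in `ℤ_P`
(`P < 2^m`, so the `m` bits determine the canonical representative). [folklore] -/
theorem eval_thirdIsOne_ddhEncode {m P : ℕ} [Fact (1 < P)] (hm : 1 ≤ m) (hP : P < 2 ^ m)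
    (C : Circuit (Fin 3 × Fin m))
    (hC : ∀ w, C.eval w = (List.finRange m).all fun j => w (2, j) == decide ((j : ℕ) = 0))
    (t : Fin 3 → ZMod P) : C.eval (ddhEncode m P t) = true ↔ t 2 = 1 := by
  haveI : NeZero P := NeZero.of_gt (Fact.out : 1 < P)
  rw [hC, show (fun j : Fin m => ddhEncode m P t (2, j) == decide ((j : ℕ) = 0)) =
      fun j : Fin m => (t 2).val.testBit j == decide ((j : ℕ) = 0) from rfl,
    all_testBit_iff hm ((ZMod.val_lt _).trans hP)]
  constructor
  · intro h
    apply ZMod.val_injective P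
    rw [h, ZMod.val_one]
  · rintro h
    rw [h, ZMod.val_one]

/-- In a DDH instance, `g^n = 1` iff `Q ∣ n`. [folklore] -/
theorem IsDDHInstance.pow_eq_one_iff {m P Q g : ℕ} (h : IsDDHInstance m P Q g) (n : ℕ) :
    (g : ZMod P) ^ n = 1 ↔ Q ∣ n := by
  rw [← h.orderOf_eq, orderOf_dvd_iff_pow_eq_one]

/-- The test circuit accepts at least `2Q - 1` Diffie–Hellman pairs (those with `a = 0` or
`b = 0`, where `g^{ab} = 1`). [folklore] -/
theorem two_mul_le_ddhRealAccept_thirdIsOne {m P Q g : ℕ} (hI : IsDDHInstance m P Q g)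
    (hm : 1 ≤ m) (C : Circuit (Fin 3 × Fin m))
    (hC : ∀ w, C.eval w = (List.finRange m).all fun j => w (2, j) == decide ((j : ℕ) = 0)) :
    2 * Q ≤ ddhRealAccept m P Q g C + 1 := by
  classical
  haveI : Fact (1 < P) := ⟨hI.prime_P.one_lt⟩
  have hQ : 0 < Q := hI.prime_Q.pos
  set z : Fin Q := ⟨0, hQ⟩ with hz
  set S : Finset (Fin Q × Fin Q) := ({z} ×ˢ Finset.univ) ∪ (Finset.univ ×ˢ {z}) with hS
  have hcardS : S.card + 1 = 2 * Q := by
    have h1 := Finset.card_union_add_card_inter ({z} ×ˢ (Finset.univ : Finset (Fin Q)))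
      ((Finset.univ : Finset (Fin Q)) ×ˢ {z})
    rw [Finset.product_inter_product, Finset.singleton_inter_of_mem (Finset.mem_univ _),
      Finset.univ_inter, Finset.card_product, Finset.card_product, Finset.card_product,
      Finset.card_singleton, Finset.card_univ, Fintype.card_fin] at h1
    rw [hS]
    omega
  have hsub : S ⊆ Finset.univ.filter fun ab : Fin Q × Fin Q => C.eval (ddhEncode m P
      ![(g : ZMod P) ^ (ab.1 : ℕ), (g : ZMod P) ^ (ab.2 : ℕ),
        (g : ZMod P) ^ ((ab.1 : ℕ) * (ab.2 : ℕ))]) = true := by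
    intro ab hab
    rw [Finset.mem_filter, eval_thirdIsOne_ddhEncode hm hI.lt_two_pow C hC]
    refine ⟨Finset.mem_univ _, ?_⟩
    have hab0 : (ab.1 : ℕ) * (ab.2 : ℕ) = 0 := by
      rw [hS, Finset.mem_union, Finset.mem_product, Finset.mem_product,
        Finset.mem_singleton, Finset.mem_singleton] at hab
      rcases hab with ⟨h, -⟩ | ⟨-, h⟩
      · rw [h, hz]; simp
      · rw [h, hz]; simp
    simp [hab0]
  have := Finset.card_le_card hsub
  unfold ddhRealAccept
  omega

/-- The test circuit accepts at most `Q²` random triples (only those with `c = 0`). [folklore] -/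
theorem ddhRandAccept_thirdIsOne_le {m P Q g : ℕ} (hI : IsDDHInstance m P Q g)
    (hm : 1 ≤ m) (C : Circuit (Fin 3 × Fin m))
    (hC : ∀ w, C.eval w = (List.finRange m).all fun j => w (2, j) == decide ((j : ℕ) = 0)) :
    ddhRandAccept m P Q g C ≤ Q ^ 2 := by
  classical
  haveI : Fact (1 < P) := ⟨hI.prime_P.one_lt⟩
  have hQ : 0 < Q := hI.prime_Q.pos
  set z : Fin Q := ⟨0, hQ⟩ with hz
  have hsub : (Finset.univ.filter fun abc : Fin Q × Fin Q × Fin Q => C.eval (ddhEncode m P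
      ![(g : ZMod P) ^ (abc.1 : ℕ), (g : ZMod P) ^ (abc.2.1 : ℕ),
        (g : ZMod P) ^ (abc.2.2 : ℕ)]) = true) ⊆
      (Finset.univ ×ˢ (Finset.univ ×ˢ {z})) := by
    intro abc habc
    rw [Finset.mem_filter, eval_thirdIsOne_ddhEncode hm hI.lt_two_pow C hC] at habc
    have h1 : (g : ZMod P) ^ (abc.2.2 : ℕ) = 1 := by simpa using habc.2
    rw [hI.pow_eq_one_iff] at h1
    have h2 : (abc.2.2 : ℕ) = 0 := Nat.eq_zero_of_dvd_of_lt h1 abc.2.2.isLt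
    simp only [Finset.mem_product, Finset.mem_univ, true_and, Finset.mem_singleton]
    exact Fin.ext h2
  refine (Finset.card_le_card hsub).trans ?_
  simp [sq]

/-- The test circuit has DDH advantage at least `(Q - 1)/Q²`. [folklore] -/
theorem ddhAdvantage_thirdIsOne_ge {m P Q g : ℕ} (hI : IsDDHInstance m P Q g) (hm : 1 ≤ m)
    (C : Circuit (Fin 3 × Fin m))
    (hC : ∀ w, C.eval w = (List.finRange m).all fun j => w (2, j) == decide ((j : ℕ) = 0)) :
    ((Q : ℝ) - 1) / (Q : ℝ) ^ 2 ≤ ddhAdvantage m P Q g C := by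
  have hQ : (0 : ℝ) < Q := by exact_mod_cast hI.prime_Q.pos
  have h1 : (2 : ℝ) * Q ≤ ddhRealAccept m P Q g C + 1 := by
    exact_mod_cast two_mul_le_ddhRealAccept_thirdIsOne hI hm C hC
  have h2 : (ddhRandAccept m P Q g C : ℝ) ≤ (Q : ℝ) ^ 2 := by
    exact_mod_cast ddhRandAccept_thirdIsOne_le hI hm C hC
  unfold ddhAdvantage
  refine le_trans ?_ (le_abs_self _)
  calc ((Q : ℝ) - 1) / (Q : ℝ) ^ 2 = (2 * Q - 1) / (Q : ℝ) ^ 2 - (Q : ℝ) ^ 2 / (Q : ℝ) ^ 3 := by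
        field_simp
        ring
    _ ≤ (ddhRealAccept m P Q g C : ℝ) / (Q : ℝ) ^ 2 - (ddhRandAccept m P Q g C : ℝ) / (Q : ℝ) ^ 3 := by
        gcongr
        linarith

/-- `m + 1 ≤ 2^{m^δ}` for all large `m` (`log m = o(m^δ)`). [folklore] -/
theorem eventually_natCast_succ_le_two_rpow {δ : ℝ} (hδ : 0 < δ) :
    ∀ᶠ m : ℕ in atTop, ((m : ℝ) + 1) ≤ (2 : ℝ) ^ ((m : ℝ) ^ δ) := by
  have hlog2 : 0 < Real.log 2 := Real.log_pos one_lt_two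
  have h1 : ∀ᶠ x : ℝ in atTop, Real.log x ≤ Real.log 2 / 2 * x ^ δ := by
    have hc : (0 : ℝ) < Real.log 2 / 2 := by positivity
    filter_upwards [(isLittleO_log_rpow_atTop hδ).bound hc, eventually_ge_atTop (1 : ℝ)]
      with x hx hx1
    rwa [Real.norm_of_nonneg (Real.log_nonneg hx1),
      Real.norm_of_nonneg (Real.rpow_nonneg (by linarith) _)] at hx
  have h2 : ∀ᶠ x : ℝ in atTop, 2 ≤ x ^ δ := (tendsto_rpow_atTop hδ).eventually_ge_atTop 2
  have h3 : ∀ᶠ x : ℝ in atTop, x + 1 ≤ (2 : ℝ) ^ (x ^ δ) := by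
    filter_upwards [h1, h2, eventually_ge_atTop (1 : ℝ)] with x hx hx2 hx1
    have h4 : Real.log 2 * 2 ≤ Real.log 2 * x ^ δ := mul_le_mul_of_nonneg_left hx2 hlog2.le
    calc x + 1 ≤ 2 * x := by linarith
      _ = Real.exp (Real.log 2 + Real.log x) := by
          rw [Real.exp_add, Real.exp_log two_pos, Real.exp_log (by linarith)]
      _ ≤ Real.exp (Real.log 2 * x ^ δ) := Real.exp_le_exp.2 (by linarith)
      _ = (2 : ℝ) ^ (x ^ δ) := by rw [Real.rpow_def_of_pos two_pos]
  exact tendsto_natCast_atTop_atTop.eventually h3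

/-- **The hardness clause forces a superpolynomially large subgroup order**: if
`DDHSubexpHard P Q g` holds with exponent `δ`, then `2^{m^δ} < 2 Q_m` for all large `m` — the
size-`(m + 1)` circuit "accept iff the third element is `1`" has advantage `(Q_m - 1)/Q_m²`, which
must be `< 2^{-m^δ}`. (Cf. p. 240: generic discrete-log algorithms run in time `√Q`, so `Q` must be
large; here only the trivial `ab = 0` bias is used.) [cite: NaorReingold2004, §3.1 (p. 240) and §3.2 (p. 242)] -/
theorem DDHSubexpHard.eventually_two_rpow_lt {P Q g : ℕ → ℕ} (h : DDHSubexpHard P Q g) :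
    ∃ δ : ℝ, 0 < δ ∧ ∀ᶠ m : ℕ in atTop, (2 : ℝ) ^ ((m : ℝ) ^ δ) < 2 * (Q m : ℝ) := by
  obtain ⟨δ, hδ, hev⟩ := h
  refine ⟨δ, hδ, ?_⟩
  filter_upwards [hev, eventually_natCast_succ_le_two_rpow hδ, eventually_ge_atTop 1]
    with m hm hsz hm1
  obtain ⟨hI, hhard⟩ := hm
  obtain ⟨C, hCB, hCs, hCe⟩ := exists_circuit_thirdIsOne m
  have hsize : (C.size : ℝ) ≤ (2 : ℝ) ^ ((m : ℝ) ^ δ) :=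
    le_trans (by exact_mod_cast hCs) hsz
  have hadv := hhard C hCB hsize
  have hlow := ddhAdvantage_thirdIsOne_ge hI hm1 C hCe
  have hQ2 : (2 : ℝ) ≤ Q m := by exact_mod_cast hI.prime_Q.two_le
  have hX : (0 : ℝ) < (2 : ℝ) ^ ((m : ℝ) ^ δ) := Real.rpow_pos_of_pos two_pos _
  have key : ((Q m : ℝ) - 1) / (Q m : ℝ) ^ 2 < ((2 : ℝ) ^ ((m : ℝ) ^ δ))⁻¹ := by
    rw [← Real.rpow_neg zero_le_two]
    exact hlow.trans_lt hadv
  rw [div_lt_iff₀ (by positivity), ← div_eq_inv_mul, lt_div_iff₀ hX] at key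
  -- key : (Q - 1) * 2^{m^δ} < Q²
  refine not_le.1 fun hcon => ?_
  have h5 : ((Q m : ℝ) - 1) * (2 * Q m) ≤ ((Q m : ℝ) - 1) * (2 : ℝ) ^ ((m : ℝ) ^ δ) :=
    mul_le_mul_of_nonneg_left hcon (by linarith)
  nlinarith

/-- In particular no instance sequence with BOUNDED subgroup order `Q_m ≤ B` is DDH-hard (e.g.
`Q_m = 2`: quadratic residuosity of `g^{ab}` is biased). [folklore] -/
theorem not_ddhSubexpHard_of_bounded {P Q g : ℕ → ℕ} {B : ℕ} (hB : ∀ m, Q m ≤ B) :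
    ¬ DDHSubexpHard P Q g := by
  intro h
  obtain ⟨δ, hδ, hev⟩ := h.eventually_two_rpow_lt
  have h2 : ∀ᶠ x : ℝ in atTop, 2 * (B : ℝ) ≤ (2 : ℝ) ^ (x ^ δ) :=
    ((tendsto_rpow_atTop hδ).eventually_ge_atTop _).mono fun x hx =>
      le_trans (by
        have : (2 : ℝ) * B ≤ (2 : ℝ) ^ ((2 : ℝ) * B) := by
          have := Real.rpow_natCast (2 : ℝ) (2 * B)
          push_cast at this
          rw [this]
          exact_mod_cast (Nat.lt_two_pow_self).le
        exact this) (Real.rpow_le_rpow_of_exponent_le one_le_two hx)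
  obtain ⟨m, hm1, hm2⟩ := (hev.and (tendsto_natCast_atTop_atTop.eventually h2)).exists
  have : (Q m : ℝ) ≤ B := by exact_mod_cast hB m
  linarith

end QLarge

end Literature.Computability.Cryptography
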